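import Mathlib
import Summits.Ventures.PercRepro2.SwAllLMarkDefs
import Summits.Ventures.PercRepro2.SwAllFreeBits
import Summits.Ventures.PercRepro2.SwAllHMarkSwap
import Summits.Ventures.PercRepro2.SwOutArmNegMark
import Summits.Ventures.PercRepro2.SwOutNeverCoreAsym

/-!
# THE MARK WITH NEIGHBOURS `p` AND `l`, II: the theorem (blind cell PercRepro2, night-4 g30,
2026-08-28; proofs/NIGHT4-G30.md §8)

**`IsLMarkAt.swAll_lMark`**: with ONE edge `e₀ = x–p` and at least one edge `x–l` at `x` (no other
edge), `x ≠ h`, row 2′SW-ALL with the mark at `x` follows from the NEGATIVE-MARK domination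
`SwAllNeg (isolate ends x) l h p` and the row `SwAll (isolate ends x) l h p` on the graph with
the edges at `x` deleted.  PROOF (counting form + Hall).  The side `Q_x` splits by the colour of
`e₀` (`IsLMarkAt.mem_tgt_iff`): with `e₀` RED it is the negative-mark side `N′(p)` of the isolated
graph on the bit pattern «every `x–l` red, `e₀` red» — FREE BITS (`card_filter_le_of_free_bits`)
restrict the counting inequality of `SwAllNeg` (`card_le_of_swAllNeg`) to the pattern; with `e₀`
BLUE it is `{h ∉ H′_l, p ∉ C′_B(l)}` on the pattern «every `x–l` red, `e₀` blue», which splits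
into the side `Q′_p` (from `SwAll` by free bits) and the swap-symmetric part `{p ∉ H′_l}` (the
colour swap off the edges at `x`, `swapOff`, injects its red count into its blue count).  On `Q_x`
the red edge set of `h` is that of the isolated graph and the blue one contains it.  Then Hall.
With the kernel theorem `swAllNeg_of_outEdges` and g10's class this settles, unconditionally, every
graph in which the mark `x` is joined to `l` and by one edge to `p` and every other vertex is
joined to `l` or isolated, `p` arbitrary (`IsLMarkAt.swAll_lMark_of_outEdges`).
-/

namespace Summit.Ventures.PercRepro2

namespace LocRows

open Hull

variable {V : Type*} {E : Type*} [Fintype E] [DecidableEq E]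

open scoped Classical

section Counting

variable {ends : E → Sym2 V}

/-- **The negative-mark domination gives the rigid counting inequality** on its side, for every
up-set. -/
lemma card_le_of_swAllNeg {l h p : V} (hs : SwAllNeg ends l h p) (𝓔 : Set (Set E))
    (h𝓔 : IsUpperSet 𝓔) :
    ((negSide ends l h p).filter fun ζ => redEdges ends ζ h ∈ 𝓔).card ≤
      ((negSide ends l h p).filter fun ζ => blueEdges ends ζ h ∈ 𝓔).card := by
  obtain ⟨f, hf, hmem⟩ := hs
  refine Finset.card_le_card_of_injOn (fun ζ => if hζ : ζ ∈ negSide ends l h p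
    then f ⟨ζ, hζ⟩ else ζ) ?_ ?_
  · intro ζ hζ
    rw [Finset.mem_coe, Finset.mem_filter] at hζ ⊢
    obtain ⟨hQ, hR⟩ := hζ
    simp only [hQ, dite_true]
    refine ⟨(hmem ⟨ζ, hQ⟩).1, h𝓔 ?_ hR⟩
    intro e' he'
    obtain ⟨hred, hin⟩ := he'
    have hsub := cluster_subset_of_red_flipped ends (hmem ⟨ζ, hQ⟩).2
    refine ⟨blue_eq_true_iff.2 ((hmem ⟨ζ, hQ⟩).2 e' hin hred), ?_⟩
    obtain ⟨a, ha, b, hb, hab⟩ := hin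
    exact ⟨a, hsub ha, b, hsub hb, hab⟩
  · intro ζ hζ ζ' hζ' heq
    rw [Finset.mem_coe, Finset.mem_filter] at hζ hζ'
    simp only [hζ.1, hζ'.1, dite_true] at heq
    exact congrArg Subtype.val (hf heq)

end Counting

section NegPrime

variable {ends : E → Sym2 V} {U : Set V} {ξ : Config E} {l h p : V}

/-- When every vertex of `U ∖ {h, p}` has an outside edge or is in no red cluster of `h` at all,
every `N(p)`-configuration of the class is core-free. -/
theorem coreFree_of_outEdges_neg'
    (hout : ∀ y ∈ U, y ≠ h → y ≠ p →
      (∃ e z, ends e = s(y, z) ∧ z ∉ U) ∨ (∀ ζ : Config E, y ∉ cluster ends ζ h))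
    {ζ : Config E} (hζ : ζ ∈ negOutSide ends l h p U ξ) : CoreFree ends ζ h := by
  intro y hyT hyTp
  by_contra hyh
  have hQ := (mem_negOutSide.1 hζ).1
  have hcl := (mem_negOutSide.1 hζ).2
  rw [mem_negSide] at hQ
  have hyU : y ∈ U := (mem_outClass.1 hcl).2 (Or.inl hyT)
  by_cases hyp : y = p
  · subst hyp
    exact hQ.2 hyT
  rcases hout y hyU hyh hyp with ⟨e, z, hyz, hzU⟩ | hnever
  · cases he : ζ e with
    | true => exact hzU ((mem_outClass.1 hcl).2 (Or.inl (mem_cluster_of_edge hyT he hyz)))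
    | false =>
      have he' : blue ζ e = true := by rw [blue_eq_true_iff]; exact he
      exact hzU ((mem_outClass.1 hcl).2 (Or.inr (mem_cluster_of_edge hyTp he' hyz)))
  · exact hnever ζ hyT

/-- **The negative-mark domination on a graph whose vertices other than `l, h, p` are joined to
`l` or in no red cluster of `h` at all** (no loop at `h`). -/
theorem swAllNeg_of_outEdges' (hlh : l ≠ h) (hloop : ∀ e, ends e ≠ s(h, h))
    (hout : ∀ y, y ≠ l → y ≠ h → y ≠ p →
      (∃ e, ends e = s(y, l)) ∨ (∀ ζ : Config E, y ∉ cluster ends ζ h)) :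
    SwAllNeg ends l h p := by
  refine exists_swAll_injection_of_card_le h _ (card_le_neg_of_classes hlh fun ξ 𝓔 h𝓔 => ?_)
  refine rigidOK_neg_of_coreFree (ξ := ξ) (by simp) hloop
    (fun _ hζ => coreFree_of_outEdges_neg' ?_ hζ) h𝓔
  intro y hy hyh hyp
  rcases hout y (by simpa using hy) hyh hyp with ⟨e, he⟩ | hnever
  · exact Or.inl ⟨e, l, he, by simp⟩
  · exact Or.inr hnever

end NegPrime

section Theorem

variable {ends : E → Sym2 V} {x p l h : V} {e₀ : E} (hm : IsLMarkAt ends x p l e₀) (hxh : x ≠ h)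
include hm hxh

/-- **The rigid counting inequality on the side of the L-mark** from the negative-mark domination
and row 2′SW-ALL with the mark at `p` on the isolated graph. -/
theorem IsLMarkAt.card_le_lMark (hneg : SwAllNeg (isolate ends x) l h p)
    (hp : SwAll (isolate ends x) l h p) (𝓔 : Set (Set E)) (h𝓔 : IsUpperSet 𝓔) :
    ((tgtU ends l h {S : Set V | x ∈ S}).filter fun ζ => redEdges ends ζ h ∈ 𝓔).card ≤
      ((tgtU ends l h {S : Set V | x ∈ S}).filter fun ζ => blueEdges ends ζ h ∈ 𝓔).card := by
  have hhx : h ≠ x := hxh.symm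
  set Qx := tgtU ends l h {S : Set V | x ∈ S} with hQx
  set Qp := tgtU (isolate ends x) l h {S : Set V | p ∈ S} with hQp
  set Np := negSide (isolate ends x) l h p with hNp
  set SR := Qx.filter fun ζ => redEdges ends ζ h ∈ 𝓔 with hSR
  set SB := Qx.filter fun ζ => blueEdges ends ζ h ∈ 𝓔 with hSB
  -- the free-bits data
  let D : Set E := {e | x ∈ ends e}
  have hPR : ∀ ζ ζ', (∀ e, e ∉ D → ζ' e = ζ e) →
      redEdges (isolate ends x) ζ h ∈ 𝓔 → redEdges (isolate ends x) ζ' h ∈ 𝓔 := by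
    intro ζ ζ' hag hR
    rw [redEdges_isolate_eq_of_agree hhx hag]
    exact hR
  have hPB : ∀ ζ ζ', (∀ e, e ∉ D → ζ' e = ζ e) →
      blueEdges (isolate ends x) ζ h ∈ 𝓔 → blueEdges (isolate ends x) ζ' h ∈ 𝓔 := by
    intro ζ ζ' hag hBl
    rw [blueEdges_isolate_eq_of_agree hhx hag]
    exact hBl
  have hagb : ∀ ζ ζ' : Config E, (∀ e, x ∉ ends e → ζ' e = ζ e) →
      ∀ e, x ∉ ends e → blue ζ' e = blue ζ e := fun ζ ζ' hag e he => by
    rw [blue_apply, blue_apply, hag e he]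
  -- the two patterns on the bits at `x`
  obtain ⟨PatA, hPatA⟩ : ∃ Pat : Config E → Prop, ∀ ζ, Pat ζ ↔
      (∀ d, ends d = s(x, l) → ζ d = true) ∧ ζ e₀ = true := ⟨_, fun _ => Iff.rfl⟩
  obtain ⟨PatB, hPatB⟩ : ∃ Pat : Config E → Prop, ∀ ζ, Pat ζ ↔
      (∀ d, ends d = s(x, l) → ζ d = true) ∧ ζ e₀ = false := ⟨_, fun _ => Iff.rfl⟩
  have hxe₀ : x ∈ ends e₀ := by rw [hm.ends₀]; exact Sym2.mem_mk_left _ _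
  have hPatA' : ∀ ζ ζ', (∀ e, e ∈ D → ζ' e = ζ e) → PatA ζ → PatA ζ' := by
    intro ζ ζ' hag hζ
    rw [hPatA] at hζ ⊢
    refine ⟨fun d hd => ?_, ?_⟩
    · rw [hag d (by show x ∈ ends d; rw [hd]; exact Sym2.mem_mk_left _ _)]; exact hζ.1 d hd
    · rw [hag e₀ hxe₀]; exact hζ.2
  have hPatB' : ∀ ζ ζ', (∀ e, e ∈ D → ζ' e = ζ e) → PatB ζ → PatB ζ' := by
    intro ζ ζ' hag hζ
    rw [hPatB] at hζ ⊢
    refine ⟨fun d hd => ?_, ?_⟩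
    · rw [hag d (by show x ∈ ends d; rw [hd]; exact Sym2.mem_mk_left _ _)]; exact hζ.1 d hd
    · rw [hag e₀ hxe₀]; exact hζ.2
  -- the saturation of the two sides of the isolated graph
  have hSN : ∀ ζ ∈ Np, ∀ ζ', (∀ e, e ∉ D → ζ' e = ζ e) → ζ' ∈ Np := by
    intro ζ hζ ζ' hag
    have hag' : ∀ e, x ∉ ends e → ζ' e = ζ e := hag
    rw [hNp, mem_negSide] at hζ ⊢
    simp only [hull] at hζ ⊢
    rw [cluster_isolate_eq_of_agree hag' l, cluster_isolate_eq_of_agree (hagb ζ ζ' hag') l,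
      cluster_isolate_eq_of_agree hag' h]
    exact hζ
  have hSQ : ∀ ζ ∈ Qp, ∀ ζ', (∀ e, e ∉ D → ζ' e = ζ e) → ζ' ∈ Qp := by
    intro ζ hζ ζ' hag
    have hag' : ∀ e, x ∉ ends e → ζ' e = ζ e := hag
    rw [hQp, LocRows.mem_tgt_iff] at hζ ⊢
    simp only [hull] at hζ ⊢
    rw [cluster_isolate_eq_of_agree hag' l, cluster_isolate_eq_of_agree (hagb ζ ζ' hag') l]
    exact hζ
  -- the three parts of the two counts
  have hsplitR := Finset.card_filter_add_card_filter_not (s := SR) (p := fun ζ => ζ e₀ = true)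
  have hsplitB := Finset.card_filter_add_card_filter_not (s := SB) (p := fun ζ => ζ e₀ = true)
  have hsplitR' := Finset.card_filter_add_card_filter_not
    (s := SR.filter fun ζ => ¬ ζ e₀ = true) (p := fun ζ => p ∈ cluster (isolate ends x) ζ l)
  have hsplitB' := Finset.card_filter_add_card_filter_not
    (s := SB.filter fun ζ => ¬ ζ e₀ = true) (p := fun ζ => p ∈ cluster (isolate ends x) ζ l)
  -- PART A: `e₀` red — the negative-mark side on the pattern A
  have hA : (SR.filter fun ζ => ζ e₀ = true).card ≤ (SB.filter fun ζ => ζ e₀ = true).card := by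
    have hle : (Np.filter fun ζ => redEdges (isolate ends x) ζ h ∈ 𝓔).card ≤
        (Np.filter fun ζ => blueEdges (isolate ends x) ζ h ∈ 𝓔).card :=
      card_le_of_swAllNeg hneg 𝓔 h𝓔
    have key := card_filter_le_of_free_bits (D := D) Np hSN _ _ hPR hPB PatA hPatA' hle
    have eR : (SR.filter fun ζ => ζ e₀ = true) =
        (Np.filter fun ζ => redEdges (isolate ends x) ζ h ∈ 𝓔).filter PatA := by
      ext ζ
      simp only [hSR, Finset.mem_filter, hPatA, hNp, mem_negSide]
      constructor
      · rintro ⟨⟨hQ, hR⟩, he₀⟩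
        obtain ⟨hd, hh, hpR, -⟩ := (hm.mem_tgt_iff hxh).1 hQ
        exact ⟨⟨⟨hh, hpR he₀⟩, by rw [← IsLMarkAt.redEdges_eq hxh hQ]; exact hR⟩, hd, he₀⟩
      · rintro ⟨⟨⟨hh, hpR⟩, hR⟩, hd, he₀⟩
        have hQ : ζ ∈ Qx := (hm.mem_tgt_iff hxh).2
          ⟨hd, hh, fun _ => hpR, fun h' => by rw [he₀] at h'; exact Bool.noConfusion h'⟩
        exact ⟨⟨hQ, by rw [IsLMarkAt.redEdges_eq hxh hQ]; exact hR⟩, he₀⟩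
    have eB : ((Np.filter fun ζ => blueEdges (isolate ends x) ζ h ∈ 𝓔).filter PatA) ⊆
        SB.filter fun ζ => ζ e₀ = true := by
      intro ζ hζ
      simp only [hSB, Finset.mem_filter, hPatA, hNp, mem_negSide] at hζ ⊢
      obtain ⟨⟨⟨hh, hpR⟩, hBl⟩, hd, he₀⟩ := hζ
      have hQ : ζ ∈ Qx := (hm.mem_tgt_iff hxh).2
        ⟨hd, hh, fun _ => hpR, fun h' => by rw [he₀] at h'; exact Bool.noConfusion h'⟩
      exact ⟨⟨hQ, h𝓔 (blueEdges_isolate_subset hhx) hBl⟩, he₀⟩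
    rw [eR]
    exact key.trans (Finset.card_le_card eB)
  -- PART B₁: `e₀` blue, `p ∈ C′_R(l)` — the side of `p` on the pattern B
  have hB1 : ((SR.filter fun ζ => ¬ ζ e₀ = true).filter
        fun ζ => p ∈ cluster (isolate ends x) ζ l).card ≤
      ((SB.filter fun ζ => ¬ ζ e₀ = true).filter
        fun ζ => p ∈ cluster (isolate ends x) ζ l).card := by
    have hle : (Qp.filter fun ζ => redEdges (isolate ends x) ζ h ∈ 𝓔).card ≤
        (Qp.filter fun ζ => blueEdges (isolate ends x) ζ h ∈ 𝓔).card :=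
      card_le_of_swAll hp 𝓔 h𝓔
    have key := card_filter_le_of_free_bits (D := D) Qp hSQ _ _ hPR hPB PatB hPatB' hle
    have eR : ((SR.filter fun ζ => ¬ ζ e₀ = true).filter
          fun ζ => p ∈ cluster (isolate ends x) ζ l) =
        (Qp.filter fun ζ => redEdges (isolate ends x) ζ h ∈ 𝓔).filter PatB := by
      ext ζ
      simp only [hSR, Finset.mem_filter, hPatB, hQp, LocRows.mem_tgt_iff, Bool.not_eq_true]
      constructor
      · rintro ⟨⟨⟨hQ, hR⟩, he₀⟩, hpR⟩
        obtain ⟨hd, hh, -, hpB⟩ := (hm.mem_tgt_iff hxh).1 hQ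
        exact ⟨⟨⟨hh, hpR, hpB he₀⟩, by rw [← IsLMarkAt.redEdges_eq hxh hQ]; exact hR⟩, hd, he₀⟩
      · rintro ⟨⟨⟨hh, hpR, hpB⟩, hR⟩, hd, he₀⟩
        have hQ : ζ ∈ Qx := (hm.mem_tgt_iff hxh).2
          ⟨hd, hh, fun h' => by rw [he₀] at h'; exact Bool.noConfusion h', fun _ => hpB⟩
        exact ⟨⟨⟨hQ, by rw [IsLMarkAt.redEdges_eq hxh hQ]; exact hR⟩, he₀⟩, hpR⟩
    have eB : ((Qp.filter fun ζ => blueEdges (isolate ends x) ζ h ∈ 𝓔).filter PatB) ⊆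
        (SB.filter fun ζ => ¬ ζ e₀ = true).filter fun ζ => p ∈ cluster (isolate ends x) ζ l := by
      intro ζ hζ
      simp only [hSB, Finset.mem_filter, hPatB, hQp, LocRows.mem_tgt_iff, Bool.not_eq_true] at hζ ⊢
      obtain ⟨⟨⟨hh, hpR, hpB⟩, hBl⟩, hd, he₀⟩ := hζ
      have hQ : ζ ∈ Qx := (hm.mem_tgt_iff hxh).2
        ⟨hd, hh, fun h' => by rw [he₀] at h'; exact Bool.noConfusion h', fun _ => hpB⟩
      exact ⟨⟨⟨hQ, h𝓔 (blueEdges_isolate_subset hhx) hBl⟩, he₀⟩, hpR⟩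
    rw [eR]
    exact key.trans (Finset.card_le_card eB)
  -- PART B₂: `e₀` blue, `p ∉ H′_l` — the colour swap off the edges at `x`
  have hB2 : ((SR.filter fun ζ => ¬ ζ e₀ = true).filter
        fun ζ => ¬ p ∈ cluster (isolate ends x) ζ l).card ≤
      ((SB.filter fun ζ => ¬ ζ e₀ = true).filter
        fun ζ => ¬ p ∈ cluster (isolate ends x) ζ l).card := by
    refine Finset.card_le_card_of_injOn (swapOff ends x) ?_ ?_
    · intro ζ hζ
      simp only [hSR, hSB, Finset.mem_coe, Finset.mem_filter, Bool.not_eq_true] at hζ ⊢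
      obtain ⟨⟨⟨hQ, hR⟩, he₀⟩, hpR⟩ := hζ
      obtain ⟨hd, hh, -, hpB⟩ := (hm.mem_tgt_iff hxh).1 hQ
      have hpB' := hpB he₀
      have hde : ∀ e, x ∈ ends e → swapOff ends x ζ e = ζ e := fun e he => swapOff_apply_of_mem he
      have he₀' : swapOff ends x ζ e₀ = false := by rw [hde e₀ hxe₀]; exact he₀
      have hQ' : swapOff ends x ζ ∈ Qx := by
        refine (hm.mem_tgt_iff hxh).2 ⟨fun d hd' => ?_, ?_, ?_, ?_⟩
        · rw [hde d (by rw [hd']; exact Sym2.mem_mk_left _ _)]; exact hd d hd'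
        · intro h1
          simp only [hull, Set.mem_union, cluster_isolate_swapOff, cluster_isolate_blue_swapOff]
            at h1
          exact hh (h1.elim Or.inr Or.inl)
        · intro h1; rw [he₀'] at h1; exact Bool.noConfusion h1
        · intro _; rw [cluster_isolate_blue_swapOff]; exact hpR
      refine ⟨⟨⟨hQ', h𝓔 ?_ hR⟩, he₀'⟩, ?_⟩
      · rw [IsLMarkAt.redEdges_eq hxh hQ, ← blueEdges_isolate_swapOff hhx ζ]
        exact blueEdges_isolate_subset hhx
      · rw [cluster_isolate_swapOff]; exact hpB'
    · intro ζ₁ _ ζ₂ _ heq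
      have := congrArg (swapOff ends x) heq
      rwa [swapOff_swapOff, swapOff_swapOff] at this
  omega

/-- **THE L-MARK STEP**: row 2′SW-ALL with the mark at `x ≠ h` — one edge `e₀ = x–p`, at least one
edge `x–l`, nothing else — follows from the negative-mark domination and the row with the mark at
`p` on the graph with the edges at `x` deleted. -/
theorem IsLMarkAt.swAll_lMark (hneg : SwAllNeg (isolate ends x) l h p)
    (hp : SwAll (isolate ends x) l h p) : SwAll ends l h x :=
  exists_swAll_injection_of_card_le h _ (hm.card_le_lMark hxh hneg hp)

/-- **Row (SW) with the L-mark.** -/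
theorem IsLMarkAt.sw_lMark (hneg : SwAllNeg (isolate ends x) l h p)
    (hp : SwAll (isolate ends x) l h p) : Sw ends l h x :=
  sw_of_swAll ends (hm.swAll_lMark hxh hneg hp)

/-- **The L-mark on g10's class, unconditionally**: every vertex other than `l, h, p, x` joined to
`l` or isolated (no loop at `h`; `p ≠ h`) — the negative-mark domination and the row at `p` hold on
the isolated graph by the kernel theorems `swAllNeg_of_outEdges'` and `swAll2_of_bridges` (the
isolated `x`, loops only, is in no cluster of `h`). -/
theorem IsLMarkAt.swAll_lMark_of_outEdges (hlh : l ≠ h) (hloop : ∀ e, ends e ≠ s(h, h))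
    (hout : ∀ y, y ≠ l → y ≠ h → y ≠ p → y ≠ x → (∃ e, ends e = s(y, l)) ∨ (∀ e, y ∉ ends e)) :
    SwAll ends l h x := by
  have hhx : h ≠ x := hxh.symm
  have hloop' : ∀ e, isolate ends x e ≠ s(h, h) := by
    intro e h'
    by_cases hxe : x ∈ ends e
    · rw [isolate_apply_of_mem hxe, Sym2.eq_iff] at h'
      rcases h' with ⟨h1, -⟩ | ⟨h1, -⟩ <;> exact hxh h1
    · rw [isolate_apply_of_notMem hxe] at h'
      exact hloop e h'
  -- the other vertices keep their edge to `l` or their isolation in the isolated graph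
  have hother : ∀ y, y ≠ l → y ≠ h → y ≠ p → y ≠ x →
      (∃ e, isolate ends x e = s(y, l)) ∨ (∀ e, y ∉ isolate ends x e) := by
    intro y hyl hyh hyp hyx
    rcases hout y hyl hyh hyp hyx with ⟨e, he⟩ | hiso
    · exact Or.inl ⟨e, isolate_eq_of_ends_eq hyx hm.xl.symm he⟩
    · refine Or.inr fun e hye => ?_
      by_cases hxe : x ∈ ends e
      · rw [isolate_apply_of_mem hxe, Sym2.mem_iff] at hye
        rcases hye with h' | h' <;> exact hyx h'
      · rw [isolate_apply_of_notMem hxe] at hye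
        exact hiso e hye
  refine hm.swAll_lMark hxh ?_ ?_
  · refine swAllNeg_of_outEdges' hlh hloop' fun y hyl hyh hyp => ?_
    by_cases hyx : y = x
    · subst hyx
      exact Or.inr fun ζ => x_notMem_cluster_isolate hhx
    · rcases hother y hyl hyh hyp hyx with h' | h'
      · exact Or.inl h'
      · exact Or.inr fun ζ hy => (exists_edge_of_mem_cluster hy hyh).elim fun e he => h' e he
  · refine swAll_of_swAll2 (swAll2_of_bridges hlh hloop' (fun _ _ hST hp => hST hp)
      (fun _ _ hST hp => hST hp) fun y hyl hyh => ?_)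
    by_cases hyp : y = p
    · subst hyp
      exact Or.inl fun S hS => hS
    by_cases hyx : y = x
    · subst hyx
      exact Or.inr (Or.inr (Or.inr ⟨e₀, x_notMem_cluster_isolate hhx⟩))
    rcases hother y hyl hyh hyp hyx with h' | h'
    · exact Or.inr (Or.inl h')
    · exact Or.inr (Or.inr (Or.inl h'))

end Theorem

end LocRows

end Summit.Ventures.PercRepro2
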